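import Mathlib.Analysis.MeanInequalities
import Mathlib.Analysis.SpecialFunctions.Pow.Real
import Mathlib.Analysis.SpecialFunctions.Pow.NNReal
import Mathlib.Analysis.SpecialFunctions.Log.Base
import HarnessLib

/-!
# `NoHeavyLowerTail` (crux stmt-CriticalPhenomena-4575), abstract sunflower cubic: an elementary POSYNOMIAL BOUND — a product of
# functions `c_i + a_i x + b_i ρ/x` (`c_i > 0`, `a_i, b_i ≥ 0`) on `ρ ≤ x ≤ 1` is at most the larger of its two endpoint values

Support file (seat `prim-ineq-prove-1` gen 34; `--supports stmt-CriticalPhenomena-4575`).  Pure real analysis (log-convexity in `log x`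
made explicit: `x = ρ^θ`, three-term Hölder with the common exponent `θ`, weighted AM–GM); no `sorry`, no named facts.  Used by
`…SunflowerKDecreasing` for the two-coordinate MERGING step of the K-decreasing-functions lemma (memo
run/shared/lean/prim/prim-ineq-prove-1/FINDING-PRINCIPALCORE-prove1-g34.md §4, Step 2).
* `sum_rpow_mul_rpow_le` — `Σ_k u_k^θ v_k^{1−θ} ≤ (Σu)^θ(Σv)^{1−θ}`;
* `posy_le_rpow` — `c + aρ^θ + bρ^{1−θ} ≤ (c + aρ + b)^θ (c + a + bρ)^{1−θ}`;
* `prod_posy_le_max` — the endpoint bound.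
-/

namespace Summit.CriticalPhenomena.PercolationContinuityZ3.Theorems.SunflowerPartition

namespace KDecreasing

open Finset Real

/-! ## The analytic inequality: a product of posynomials `c + a x + b ρ/x` on `[ρ, 1]` is below its larger endpoint value -/

section Posy

/-- Three-term Hölder inequality with a common exponent `θ ∈ [0,1]`:
`Σ_k u_k^θ v_k^{1−θ} ≤ (Σ u)^θ (Σ v)^{1−θ}` (weighted AM–GM after normalisation). [folklore] -/
theorem sum_rpow_mul_rpow_le {ι : Type*} (s : Finset ι) (u v : ι → ℝ) (hu : ∀ k ∈ s, 0 ≤ u k) (hv : ∀ k ∈ s, 0 ≤ v k)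
    {θ : ℝ} (h0 : 0 ≤ θ) (h1 : θ ≤ 1) (hU : 0 < ∑ k ∈ s, u k) (hV : 0 < ∑ k ∈ s, v k) :
    ∑ k ∈ s, u k ^ θ * v k ^ (1 - θ) ≤ (∑ k ∈ s, u k) ^ θ * (∑ k ∈ s, v k) ^ (1 - θ) := by
  set U := ∑ k ∈ s, u k
  set V := ∑ k ∈ s, v k
  have hUθ : 0 < U ^ θ := Real.rpow_pos_of_pos hU θ
  have hVθ : 0 < V ^ (1 - θ) := Real.rpow_pos_of_pos hV (1 - θ)
  have key : ∀ k ∈ s, u k ^ θ * v k ^ (1 - θ) ≤ U ^ θ * V ^ (1 - θ) * (θ * (u k / U) + (1 - θ) * (v k / V)) := by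
    intro k hk
    have hg := Real.geom_mean_le_arith_mean2_weighted h0 (by linarith) (div_nonneg (hu k hk) hU.le)
      (div_nonneg (hv k hk) hV.le) (by ring : θ + (1 - θ) = 1)
    rw [Real.div_rpow (hu k hk) hU.le, Real.div_rpow (hv k hk) hV.le] at hg
    have e1 : u k ^ θ * v k ^ (1 - θ) = U ^ θ * V ^ (1 - θ) * (u k ^ θ / U ^ θ * (v k ^ (1 - θ) / V ^ (1 - θ))) := by
      field_simp
    rw [e1]
    exact mul_le_mul_of_nonneg_left hg (mul_pos hUθ hVθ).le
  calc ∑ k ∈ s, u k ^ θ * v k ^ (1 - θ)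
      ≤ ∑ k ∈ s, U ^ θ * V ^ (1 - θ) * (θ * (u k / U) + (1 - θ) * (v k / V)) := Finset.sum_le_sum key
    _ = U ^ θ * V ^ (1 - θ) * (θ * ((∑ k ∈ s, u k) / U) + (1 - θ) * ((∑ k ∈ s, v k) / V)) := by
        rw [← Finset.mul_sum, Finset.sum_add_distrib, ← Finset.mul_sum, ← Finset.mul_sum, Finset.sum_div,
          Finset.sum_div]
    _ = U ^ θ * V ^ (1 - θ) := by
        rw [div_self hU.ne', div_self hV.ne']; ring

/-- One posynomial factor at `x = ρ^θ`: `c + a·ρ^θ + b·ρ^{1−θ} ≤ (c + aπ + b)^θ (c + a + bπ)^{1−θ}`. [this work] -/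
theorem posy_le_rpow {c a b ρ θ : ℝ} (hc : 0 < c) (ha : 0 ≤ a) (hb : 0 ≤ b) (hπ : 0 ≤ ρ) (h0 : 0 ≤ θ) (h1 : θ ≤ 1) :
    c + a * ρ ^ θ + b * ρ ^ (1 - θ) ≤ (c + a * ρ + b) ^ θ * (c + a + b * ρ) ^ (1 - θ) := by
  -- write the three terms as `u^θ v^{1-θ}`
  have hθ1 : θ + (1 - θ) ≠ 0 := by norm_num
  have t1 : c = c ^ θ * c ^ (1 - θ) := by
    rw [← Real.rpow_add' hc.le hθ1]; norm_num
  have t2 : a * ρ ^ θ = (a * ρ) ^ θ * a ^ (1 - θ) := by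
    rw [Real.mul_rpow ha hπ, mul_assoc, mul_comm (ρ ^ θ), ← mul_assoc, ← Real.rpow_add' ha hθ1]; norm_num
  have t3 : b * ρ ^ (1 - θ) = b ^ θ * (b * ρ) ^ (1 - θ) := by
    rw [Real.mul_rpow hb hπ, ← mul_assoc, ← Real.rpow_add' hb hθ1]; norm_num
  have key := sum_rpow_mul_rpow_le (Finset.univ : Finset (Fin 3)) ![c, a * ρ, b] ![c, a, b * ρ]
    (by intro k _; fin_cases k <;> simp <;> positivity) (by intro k _; fin_cases k <;> simp <;> positivity) h0 h1
    (by simp [Fin.sum_univ_three]; positivity) (by simp [Fin.sum_univ_three]; positivity)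
  simp only [Fin.sum_univ_three, Matrix.cons_val_zero, Matrix.cons_val_one, Matrix.cons_val] at key
  calc c + a * ρ ^ θ + b * ρ ^ (1 - θ) = c ^ θ * c ^ (1 - θ) + (a * ρ) ^ θ * a ^ (1 - θ) + b ^ θ * (b * ρ) ^ (1 - θ) := by
        rw [← t1, ← t2, ← t3]
    _ ≤ (c + a * ρ + b) ^ θ * (c + a + b * ρ) ^ (1 - θ) := key

/-- **A product of posynomials `c_i + a_i x + b_i ρ/x` (`c_i > 0`, `a_i, b_i ≥ 0`) on `ρ ≤ x ≤ 1` is bounded by the larger of its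
values at the endpoints `x = ρ` and `x = 1`** (log-convexity in `log x`). [this work] -/
theorem prod_posy_le_max {ι : Type*} (s : Finset ι) (c a b : ι → ℝ) (hc : ∀ i ∈ s, 0 < c i) (ha : ∀ i ∈ s, 0 ≤ a i)
    (hb : ∀ i ∈ s, 0 ≤ b i) {ρ x : ℝ} (hπ0 : 0 < ρ) (hπ1 : ρ < 1) (hx : ρ ≤ x) (hx1 : x ≤ 1) :
    ∏ i ∈ s, (c i + a i * x + b i * (ρ / x)) ≤
      max (∏ i ∈ s, (c i + a i * ρ + b i)) (∏ i ∈ s, (c i + a i + b i * ρ)) := by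
  have hx0 : 0 < x := lt_of_lt_of_le hπ0 hx
  set θ := Real.logb ρ x with hθ
  have hπne : ρ ≠ 1 := ne_of_lt hπ1
  have hxθ : ρ ^ θ = x := Real.rpow_logb hπ0 hπne hx0
  have h0 : 0 ≤ θ := Real.logb_nonneg_of_base_lt_one hπ0 hπ1 hx0 hx1
  have h1 : θ ≤ 1 := by
    have h := (Real.logb_le_logb_of_base_lt_one hπ0 hπ1 hx0 hπ0).2 hx
    rwa [Real.logb_self_eq_one_iff.2 ⟨hπ0.ne', hπne, by linarith⟩] at h
  have hπx : ρ / x = ρ ^ (1 - θ) := by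
    rw [Real.rpow_sub hπ0, Real.rpow_one, hxθ]
  -- factorwise bound
  have hfac : ∀ i ∈ s, c i + a i * x + b i * (ρ / x) ≤ (c i + a i * ρ + b i) ^ θ * (c i + a i + b i * ρ) ^ (1 - θ) := by
    intro i hi
    rw [hπx, ← hxθ]
    exact posy_le_rpow (hc i hi) (ha i hi) (hb i hi) hπ0.le h0 h1
  have hpos : ∀ i ∈ s, 0 ≤ c i + a i * x + b i * (ρ / x) := fun i hi => by
    have := hc i hi; have := ha i hi; have := hb i hi; positivity
  have hA : ∀ i ∈ s, 0 ≤ c i + a i * ρ + b i := fun i hi => by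
    have := hc i hi; have := ha i hi; have := hb i hi; positivity
  have hB : ∀ i ∈ s, 0 ≤ c i + a i + b i * ρ := fun i hi => by
    have := hc i hi; have := ha i hi; have := hb i hi; positivity
  calc ∏ i ∈ s, (c i + a i * x + b i * (ρ / x))
      ≤ ∏ i ∈ s, (c i + a i * ρ + b i) ^ θ * (c i + a i + b i * ρ) ^ (1 - θ) := Finset.prod_le_prod hpos hfac
    _ = (∏ i ∈ s, (c i + a i * ρ + b i)) ^ θ * (∏ i ∈ s, (c i + a i + b i * ρ)) ^ (1 - θ) := by
        rw [Finset.prod_mul_distrib, Real.finsetProd_rpow s _ hA, Real.finsetProd_rpow s _ hB]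
    _ ≤ θ * ∏ i ∈ s, (c i + a i * ρ + b i) + (1 - θ) * ∏ i ∈ s, (c i + a i + b i * ρ) :=
        Real.geom_mean_le_arith_mean2_weighted h0 (by linarith) (Finset.prod_nonneg hA) (Finset.prod_nonneg hB) (by ring)
    _ ≤ θ * max (∏ i ∈ s, (c i + a i * ρ + b i)) (∏ i ∈ s, (c i + a i + b i * ρ)) +
          (1 - θ) * max (∏ i ∈ s, (c i + a i * ρ + b i)) (∏ i ∈ s, (c i + a i + b i * ρ)) := by
        exact add_le_add (mul_le_mul_of_nonneg_left (le_max_left _ _) h0)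
          (mul_le_mul_of_nonneg_left (le_max_right _ _) (by linarith))
    _ = max (∏ i ∈ s, (c i + a i * ρ + b i)) (∏ i ∈ s, (c i + a i + b i * ρ)) := by ring

end Posy

end KDecreasing

end Summit.CriticalPhenomena.PercolationContinuityZ3.Theorems.SunflowerPartition
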